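import Summits.HodgeConjecture.HodgeConjecture.Theorems.CYFormCasimirCYFormCarrierEightDuality
import HarnessLib

/-!
# Crux X1 `CYFormCarrierEight` (route `CYFormCasimir`, stmt-HodgeConjecture-23493), helper file 14:
# EXISTENCE of the duality operators `s₊ : ⋀⁴W → ⋀⁴W^*`, `s₋ : ⋀⁴W^* → ⋀⁴W` (the two halves of the Hodge star)

research route conditional on HC_CM; not a corollary. Nothing here proves HC, HC_CM, the rung H2, X1 or
`stub_cyform_exists`; step S2 of `Cruxes/CYFormCarrierEight/STUB-PLAN-stub_cyform_exists.md`.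

For a Hodge-general `ℚ(√-d)`-Weil eightfold `(A, φ)` (`Hg = SU_H`), `E₊ = ⋀⁴W`, `E₋ = ⋀⁴W^*`, `tr = topCoord` and classes
`v, v' ∈ H⁸(A(ℂ); ℂ)` (later: the two components of a rational Weil class), there are `ℂ`-linear operators on `H⁴(A(ℂ); ℂ)`
* `s₊` with `s₊(H⁴) ⊆ E₋`, `s₊(E₋) = 0` and **`tr((z ∪ s₊ x) ∪ h_K⁴) = tr((z ∪ x) ∪ v)` for all `x, z ∈ E₊`**
  (`exists_starPlus`) — Friedman–Laza's `⋆ : ⋀ⁿW → ⋀ⁿW̄`, `⟨z, ⋆x⟩_H = (z ∧ x)/η`, with the `SU_H`-invariant pairing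
  `β(z, y) = tr((z ∪ y) ∪ h_K⁴)` (PERFECT: helper file 13) in place of `⟨·,·⟩_H` and `tr((· ∪ ·) ∪ v)` in place of `(· ∧ ·)/η`;
* `s₋` with `s₋(H⁴) ⊆ E₊`, `s₋(E₊) = 0` and `tr((z' ∪ s₋ y) ∪ h_K⁴) = tr((z' ∪ y) ∪ v')` for all `y, z' ∈ E₋` (`exists_starMinus`).
They are built in a Weil frame by `Basis.constr` (`w_I ↦ c_I w^*_{Iᶜ}`); the defining identity is checked on monomials
(`β` diagonal with non-zero diagonal, `w_J ∪ w_I = 0` unless `J = Iᶜ`) and extended bilinearly. Uniqueness and all further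
properties (equivariance, eigenvalue, rationality) are derived from the defining identities in helper files 15 ff.

References: FriedmanLaza2013 (§3.5 Lemma 36, Prop. 37), vanGeemen1994HodgeAV (proof of Thm. 6.12), LangeBirkenhake1992 (Lemma 1.1.17).
-/

-- `Summit.HodgeConjecture.HodgeConjecture.…` is the tree's mandated summit/problem namespace (single-problem summit).
set_option linter.dupNamespace false
noncomputable section

open CategoryTheory
open Literature.AlgebraicTopology.SingularHomology
open Literature.AlgebraicGeometry.Motives
open Literature.AlgebraicGeometry.HodgeTheory
open Literature.AlgebraicGeometry.VanGeemen1994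

namespace Summit.HodgeConjecture.HodgeConjecture.Theorems.CYFormCarrier

section Star

variable {A : AbelianVariety ℂ} {d : ℕ} {φ : A ⟶ A}
variable (hd : 0 < d) (hA : A.dim = 2 * 4) (hφ : φ ≫ φ = -(d • 𝟙 A))
  (e : ProjectiveEmbedding A.X) {a : complexBetti (projectiveSpace e.n ℂ) 2} (ha : IsRationalClass a)
  (ha0 : a ≠ 0) (w : Module.Basis (Fin (2 * 4)) ℂ (eigW A φ d))
  (b : Module.Basis (Fin (2 * 4 + 2 * 4)) ℂ (complexBetti A.X 1))
  (hb : b = weilBasis (m := 2 * 4 - 1) (k := 2 * 4) (by omega) (by omega) hd hφ e ha ha0 w)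

/-- `castAdd(I)` has first-block projection of cardinality `4 ≠ 0`. [folklore] -/
theorem projW_card_map_castAddEmb_ne_zero (I : Set.powersetCard (Fin (2 * 4)) (2 * 2)) :
    (projW (Set.powersetCard.map (2 * 2) (Fin.castAddEmb (2 * 4)) I).val).card ≠ 0 := by
  have h := CYFormSquare.card_eq_card_projW_add (Set.powersetCard.map (2 * 2) (Fin.castAddEmb (2 * 4)) I).val
  rw [filter_natAdd_card_map_castAddEmb, add_zero, Set.powersetCard.card_eq] at h
  omega

/-- `natAdd(K)` has second-block part of cardinality `4 ≠ 0`. [folklore] -/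
theorem filter_natAdd_card_map_natAddEmb_ne_zero (K : Set.powersetCard (Fin (2 * 4)) (2 * 2)) :
    (Finset.univ.filter fun j : Fin (2 * 4) ↦
      Fin.natAdd (2 * 4) j ∈ (Set.powersetCard.map (2 * 2) (Fin.natAddEmb (2 * 4)) K).val).card ≠ 0 := by
  classical
  have h := CYFormSquare.card_eq_card_projW_add (Set.powersetCard.map (2 * 2) (Fin.natAddEmb (2 * 4)) K).val
  rw [projW_card_map_natAddEmb, zero_add, Set.powersetCard.card_eq] at h
  omega

include hb hd hA hφ e ha ha0 in
/-- **Existence of `s₊`.** In a Weil frame put `s₊(w_I) := c_I · w^*_{Iᶜ}` with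
`c_I = tr((w_{Iᶜ} ∪ w_I) ∪ v) / tr((w_{Iᶜ} ∪ w^*_{Iᶜ}) ∪ h_K⁴)` and `s₊ := 0` on all other monomials. Then `s₊(H⁴) ⊆ ⋀⁴W^*`,
`s₊(⋀⁴W^*) = 0`, and `tr((z ∪ s₊ x) ∪ h_K⁴) = tr((z ∪ x) ∪ v)` for all `x, z ∈ ⋀⁴W` (checked on monomials: both sides vanish unless
`z = w_{Iᶜ}`, `x = w_I`; extended bilinearly). [cite: FriedmanLaza2013, §3.5 Lemma 36] [cite: vanGeemen1994HodgeAV, proof of Thm. 6.12] -/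
theorem exists_starPlus (hSU : HasHodgeGroupSU A φ 4 d (hK d φ e a)) (hqk : 2 * 2 + 2 * 2 = Fintype.card (Fin (2 * 4)))
    (v : complexBetti A.X (2 * 4)) :
    ∃ S : complexBetti A.X (2 * 2) →ₗ[ℂ] complexBetti A.X (2 * 2),
      (∀ x, S x ∈ weilClassesMinus A φ 2 d) ∧
      (∀ y ∈ weilClassesMinus A φ 2 d, S y = 0) ∧
      (∀ x ∈ weilClassesPlus A φ 2 d, ∀ z ∈ weilClassesPlus A φ 2 d,
        topCoord (dim_eq_seven_add_one hA)
            (cupProduct (show 2 * 4 + 2 * 4 = 2 + 2 * 7 from rfl)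
              (cupProduct (show 2 * 2 + 2 * 2 = 2 * 4 from rfl) z (S x)) (cupPowTwo (hK d φ e a) 4)) =
          topCoord (dim_eq_seven_add_one hA)
            (cupProduct (show 2 * 4 + 2 * 4 = 2 + 2 * 7 from rfl)
              (cupProduct (show 2 * 2 + 2 * 2 = 2 * 4 from rfl) z x) v)) := by
  classical
  set B := monB b (2 * 2) with hB
  -- frame data
  set wP : Set.powersetCard (Fin (2 * 4)) (2 * 2) → complexBetti A.X (2 * 2) :=
    fun I ↦ monB b (2 * 2) (Set.powersetCard.map (2 * 2) (Fin.castAddEmb (2 * 4)) I) with hwP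
  set wM : Set.powersetCard (Fin (2 * 4)) (2 * 2) → complexBetti A.X (2 * 2) :=
    fun K ↦ monB b (2 * 2) (Set.powersetCard.map (2 * 2) (Fin.natAddEmb (2 * 4)) K) with hwM
  set Ic : Set.powersetCard (Fin (2 * 4)) (2 * 2) → Set.powersetCard (Fin (2 * 4)) (2 * 2) :=
    fun I ↦ Set.powersetCard.compl hqk I with hIc
  set c : Set.powersetCard (Fin (2 * 4)) (2 * 2) → ℂ := fun I ↦
      topCoord (dim_eq_seven_add_one hA)
        (cupProduct (show 2 * 4 + 2 * 4 = 2 + 2 * 7 from rfl) (cupProduct (show 2 * 2 + 2 * 2 = 2 * 4 from rfl) (wP (Ic I)) (wP I)) v) /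
      topCoord (dim_eq_seven_add_one hA)
        (cupProduct (show 2 * 4 + 2 * 4 = 2 + 2 * 7 from rfl) (cupProduct (show 2 * 2 + 2 * 2 = 2 * 4 from rfl) (wP (Ic I)) (wM (Ic I))) (cupPowTwo (hK d φ e a) 4)) with hc
  set f : Set.powersetCard (Fin (2 * 4 + 2 * 4)) (2 * 2) → complexBetti A.X (2 * 2) :=
    fun s ↦ ∑ I, if s = Set.powersetCard.map (2 * 2) (Fin.castAddEmb (2 * 4)) I then c I • wM (Ic I) else 0 with hf
  set S : complexBetti A.X (2 * 2) →ₗ[ℂ] complexBetti A.X (2 * 2) := B.constr ℂ f with hS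
  -- values of `f`
  have hf_plus : ∀ I, f (Set.powersetCard.map (2 * 2) (Fin.castAddEmb (2 * 4)) I) = c I • wM (Ic I) := by
    intro I
    rw [hf]
    change (∑ I', if Set.powersetCard.map (2 * 2) (Fin.castAddEmb (2 * 4)) I =
      Set.powersetCard.map (2 * 2) (Fin.castAddEmb (2 * 4)) I' then c I' • wM (Ic I') else 0) = _
    rw [Finset.sum_eq_single I]
    · rw [if_pos rfl]
    · intro I' _ hI'
      rw [if_neg (fun h ↦ hI' (map_castAddEmb_injective h).symm)]
    · intro h; exact absurd (Finset.mem_univ I) h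
  have hf_other : ∀ s, (∀ I, s ≠ Set.powersetCard.map (2 * 2) (Fin.castAddEmb (2 * 4)) I) → f s = 0 := by
    intro s hs
    rw [hf]
    exact Finset.sum_eq_zero fun I _ ↦ by rw [if_neg (hs I)]
  have hf_mem : ∀ s, f s ∈ weilClassesMinus A φ 2 d := by
    intro s
    by_cases h : ∃ I, s = Set.powersetCard.map (2 * 2) (Fin.castAddEmb (2 * 4)) I
    · obtain ⟨I, rfl⟩ := h
      rw [hf_plus]
      exact Submodule.smul_mem _ _ (monB_frame_natAdd_mem_weilClassesMinus hd hA hφ e ha ha0 w b hb _)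
    · push Not at h
      rw [hf_other s h]
      exact Submodule.zero_mem _
  have hSB : ∀ s, S (B s) = f s := fun s ↦ by rw [hS, Module.Basis.constr_basis]
  refine ⟨S, ?_, ?_, ?_⟩
  · -- range in `⋀⁴W^*`
    intro x
    rw [← B.sum_repr x, map_sum]
    exact Submodule.sum_mem _ fun s _ ↦ by rw [map_smul, hSB]; exact Submodule.smul_mem _ _ (hf_mem s)
  · -- kills `⋀⁴W^*`
    intro y hy
    rw [← B.sum_repr y, map_sum]
    refine Finset.sum_eq_zero fun s _ ↦ ?_
    rw [map_smul, hSB]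
    by_cases h : ∃ I, s = Set.powersetCard.map (2 * 2) (Fin.castAddEmb (2 * 4)) I
    · obtain ⟨I, rfl⟩ := h
      rw [hB, repr_frame_eq_zero_of_mem_weilClassesMinus_two hd hA hφ e ha ha0 w b hb hy _
        (projW_card_map_castAddEmb_ne_zero I), zero_smul]
    · push Not at h
      rw [hf_other s h, smul_zero]
  · -- the defining identity, first on monomials
    have key : ∀ J I, topCoord (dim_eq_seven_add_one hA)
        (cupProduct (show 2 * 4 + 2 * 4 = 2 + 2 * 7 from rfl) (cupProduct (show 2 * 2 + 2 * 2 = 2 * 4 from rfl) (wP J) (S (wP I))) (cupPowTwo (hK d φ e a) 4)) =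
        topCoord (dim_eq_seven_add_one hA)
        (cupProduct (show 2 * 4 + 2 * 4 = 2 + 2 * 7 from rfl) (cupProduct (show 2 * 2 + 2 * 2 = 2 * 4 from rfl) (wP J) (wP I)) v) := by
      intro J I
      have hSI : S (wP I) = c I • wM (Ic I) := by
        change S (B (Set.powersetCard.map (2 * 2) (Fin.castAddEmb (2 * 4)) I)) = _
        rw [hSB, hf_plus]
      rw [hSI, map_smul, map_smul, LinearMap.smul_apply, map_smul, smul_eq_mul]
      by_cases hJ : J = Ic I
      · subst hJ
        have hne := beta_frame_diag_ne_zero hd hA hφ e ha ha0 w b hb hSU (Ic I)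
        exact div_mul_cancel₀ _ hne
      · rw [beta_frame_eq_zero_of_ne hd hA hφ e ha ha0 w b hb hSU J (Ic I) hJ, mul_zero,
          cup_frame_castAdd_eq_zero_of_ne_compl b hqk I J hJ, LinearMap.map_zero₂, map_zero]
    -- extend in `x`
    have keyx : ∀ J, ∀ x ∈ weilClassesPlus A φ 2 d,
        topCoord (dim_eq_seven_add_one hA)
        (cupProduct (show 2 * 4 + 2 * 4 = 2 + 2 * 7 from rfl) (cupProduct (show 2 * 2 + 2 * 2 = 2 * 4 from rfl) (wP J) (S x)) (cupPowTwo (hK d φ e a) 4)) = topCoord (dim_eq_seven_add_one hA)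
        (cupProduct (show 2 * 4 + 2 * 4 = 2 + 2 * 7 from rfl) (cupProduct (show 2 * 2 + 2 * 2 = 2 * 4 from rfl) (wP J) x) v) := by
      intro J x hx
      set L₁ : complexBetti A.X (2 * 2) →ₗ[ℂ] ℂ := (topCoord (dim_eq_seven_add_one hA) ∘ₗ
        ((cupProduct (show 2 * 4 + 2 * 4 = 2 + 2 * 7 from rfl)).flip (cupPowTwo (hK d φ e a) 4)) ∘ₗ
          (cupProduct (show 2 * 2 + 2 * 2 = 2 * 4 from rfl) (wP J))) ∘ₗ S with hL₁
      set L₂ : complexBetti A.X (2 * 2) →ₗ[ℂ] ℂ := topCoord (dim_eq_seven_add_one hA) ∘ₗ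
        ((cupProduct (show 2 * 4 + 2 * 4 = 2 + 2 * 7 from rfl)).flip v) ∘ₗ
          (cupProduct (show 2 * 2 + 2 * 2 = 2 * 4 from rfl) (wP J)) with hL₂
      have h12 : Set.EqOn L₁ L₂ (Set.range wP) := by
        rintro _ ⟨I, rfl⟩
        exact key J I
      have h := LinearMap.eqOn_span h12 (weilClassesPlus_two_le_span_frame hd hA hφ e ha ha0 w b hb hx)
      exact h
    -- extend in `z`
    intro x hx z hz
    set L₃ : complexBetti A.X (2 * 2) →ₗ[ℂ] ℂ := topCoord (dim_eq_seven_add_one hA) ∘ₗ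
      ((cupProduct (show 2 * 4 + 2 * 4 = 2 + 2 * 7 from rfl)).flip (cupPowTwo (hK d φ e a) 4)) ∘ₗ
        ((cupProduct (show 2 * 2 + 2 * 2 = 2 * 4 from rfl)).flip (S x)) with hL₃
    set L₄ : complexBetti A.X (2 * 2) →ₗ[ℂ] ℂ := topCoord (dim_eq_seven_add_one hA) ∘ₗ
      ((cupProduct (show 2 * 4 + 2 * 4 = 2 + 2 * 7 from rfl)).flip v) ∘ₗ
        ((cupProduct (show 2 * 2 + 2 * 2 = 2 * 4 from rfl)).flip x) with hL₄
    have h34 : Set.EqOn L₃ L₄ (Set.range wP) := by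
      rintro _ ⟨J, rfl⟩
      exact keyx J x hx
    exact LinearMap.eqOn_span h34 (weilClassesPlus_two_le_span_frame hd hA hφ e ha ha0 w b hb hz)

include hb hd hA hφ e ha ha0 in
/-- **Existence of `s₋`.** In a Weil frame put `s₋(w^*_K) := c'_K · w_{Kᶜ}` with
`c'_K = tr((w^*_{Kᶜ} ∪ w^*_K) ∪ v') / tr((w^*_{Kᶜ} ∪ w_{Kᶜ}) ∪ h_K⁴)` and `s₋ := 0` on all other monomials. Then
`s₋(H⁴) ⊆ ⋀⁴W`, `s₋(⋀⁴W) = 0`, and `tr((z' ∪ s₋ y) ∪ h_K⁴) = tr((z' ∪ y) ∪ v')` for all `y, z' ∈ ⋀⁴W^*`.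
[cite: FriedmanLaza2013, §3.5 Lemma 36] [cite: vanGeemen1994HodgeAV, proof of Thm. 6.12] -/
theorem exists_starMinus (hSU : HasHodgeGroupSU A φ 4 d (hK d φ e a)) (hqk : 2 * 2 + 2 * 2 = Fintype.card (Fin (2 * 4)))
    (v' : complexBetti A.X (2 * 4)) :
    ∃ S' : complexBetti A.X (2 * 2) →ₗ[ℂ] complexBetti A.X (2 * 2),
      (∀ y, S' y ∈ weilClassesPlus A φ 2 d) ∧
      (∀ x ∈ weilClassesPlus A φ 2 d, S' x = 0) ∧
      (∀ y ∈ weilClassesMinus A φ 2 d, ∀ z' ∈ weilClassesMinus A φ 2 d,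
        topCoord (dim_eq_seven_add_one hA)
            (cupProduct (show 2 * 4 + 2 * 4 = 2 + 2 * 7 from rfl)
              (cupProduct (show 2 * 2 + 2 * 2 = 2 * 4 from rfl) z' (S' y)) (cupPowTwo (hK d φ e a) 4)) =
          topCoord (dim_eq_seven_add_one hA)
            (cupProduct (show 2 * 4 + 2 * 4 = 2 + 2 * 7 from rfl)
              (cupProduct (show 2 * 2 + 2 * 2 = 2 * 4 from rfl) z' y) v')) := by
  classical
  set B := monB b (2 * 2) with hB
  set wP : Set.powersetCard (Fin (2 * 4)) (2 * 2) → complexBetti A.X (2 * 2) :=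
    fun I ↦ monB b (2 * 2) (Set.powersetCard.map (2 * 2) (Fin.castAddEmb (2 * 4)) I) with hwP
  set wM : Set.powersetCard (Fin (2 * 4)) (2 * 2) → complexBetti A.X (2 * 2) :=
    fun K ↦ monB b (2 * 2) (Set.powersetCard.map (2 * 2) (Fin.natAddEmb (2 * 4)) K) with hwM
  set Ic : Set.powersetCard (Fin (2 * 4)) (2 * 2) → Set.powersetCard (Fin (2 * 4)) (2 * 2) :=
    fun I ↦ Set.powersetCard.compl hqk I with hIc
  set c' : Set.powersetCard (Fin (2 * 4)) (2 * 2) → ℂ := fun K ↦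
      topCoord (dim_eq_seven_add_one hA)
        (cupProduct (show 2 * 4 + 2 * 4 = 2 + 2 * 7 from rfl) (cupProduct (show 2 * 2 + 2 * 2 = 2 * 4 from rfl) (wM (Ic K)) (wM K)) v') /
      topCoord (dim_eq_seven_add_one hA)
        (cupProduct (show 2 * 4 + 2 * 4 = 2 + 2 * 7 from rfl) (cupProduct (show 2 * 2 + 2 * 2 = 2 * 4 from rfl) (wM (Ic K)) (wP (Ic K))) (cupPowTwo (hK d φ e a) 4)) with hc'
  set f : Set.powersetCard (Fin (2 * 4 + 2 * 4)) (2 * 2) → complexBetti A.X (2 * 2) :=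
    fun s ↦ ∑ K, if s = Set.powersetCard.map (2 * 2) (Fin.natAddEmb (2 * 4)) K then c' K • wP (Ic K) else 0 with hf
  set S' : complexBetti A.X (2 * 2) →ₗ[ℂ] complexBetti A.X (2 * 2) := B.constr ℂ f with hS'
  have hf_minus : ∀ K, f (Set.powersetCard.map (2 * 2) (Fin.natAddEmb (2 * 4)) K) = c' K • wP (Ic K) := by
    intro K
    rw [hf]
    change (∑ K', if Set.powersetCard.map (2 * 2) (Fin.natAddEmb (2 * 4)) K =
      Set.powersetCard.map (2 * 2) (Fin.natAddEmb (2 * 4)) K' then c' K' • wP (Ic K') else 0) = _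
    rw [Finset.sum_eq_single K]
    · rw [if_pos rfl]
    · intro K' _ hK'
      rw [if_neg (fun h ↦ hK' (map_natAddEmb_injective h).symm)]
    · intro h; exact absurd (Finset.mem_univ K) h
  have hf_other : ∀ s, (∀ K, s ≠ Set.powersetCard.map (2 * 2) (Fin.natAddEmb (2 * 4)) K) → f s = 0 := by
    intro s hs
    rw [hf]
    exact Finset.sum_eq_zero fun K _ ↦ by rw [if_neg (hs K)]
  have hf_mem : ∀ s, f s ∈ weilClassesPlus A φ 2 d := by
    intro s
    by_cases h : ∃ K, s = Set.powersetCard.map (2 * 2) (Fin.natAddEmb (2 * 4)) K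
    · obtain ⟨K, rfl⟩ := h
      rw [hf_minus]
      exact Submodule.smul_mem _ _ (monB_frame_castAdd_mem_weilClassesPlus hd hA hφ e ha ha0 w b hb _)
    · push Not at h
      rw [hf_other s h]
      exact Submodule.zero_mem _
  have hSB : ∀ s, S' (B s) = f s := fun s ↦ by rw [hS', Module.Basis.constr_basis]
  -- the diagonal in the order `(w^*, w)`
  have hdiag' : ∀ J, topCoord (dim_eq_seven_add_one hA)
        (cupProduct (show 2 * 4 + 2 * 4 = 2 + 2 * 7 from rfl) (cupProduct (show 2 * 2 + 2 * 2 = 2 * 4 from rfl) (wM J) (wP J)) (cupPowTwo (hK d φ e a) 4)) ≠ 0 := by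
    intro J
    rw [cupProduct_comm_four]
    exact beta_frame_diag_ne_zero hd hA hφ e ha ha0 w b hb hSU J
  refine ⟨S', ?_, ?_, ?_⟩
  · intro y
    rw [← B.sum_repr y, map_sum]
    exact Submodule.sum_mem _ fun s _ ↦ by rw [map_smul, hSB]; exact Submodule.smul_mem _ _ (hf_mem s)
  · intro x hx
    rw [← B.sum_repr x, map_sum]
    refine Finset.sum_eq_zero fun s _ ↦ ?_
    rw [map_smul, hSB]
    by_cases h : ∃ K, s = Set.powersetCard.map (2 * 2) (Fin.natAddEmb (2 * 4)) K
    · obtain ⟨K, rfl⟩ := h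
      rw [hB, repr_frame_eq_zero_of_mem_weilClassesPlus_two hd hA hφ e ha ha0 w b hb hx _
        (filter_natAdd_card_map_natAddEmb_ne_zero K), zero_smul]
    · push Not at h
      rw [hf_other s h, smul_zero]
  · have key : ∀ L K, topCoord (dim_eq_seven_add_one hA)
        (cupProduct (show 2 * 4 + 2 * 4 = 2 + 2 * 7 from rfl) (cupProduct (show 2 * 2 + 2 * 2 = 2 * 4 from rfl) (wM L) (S' (wM K))) (cupPowTwo (hK d φ e a) 4)) =
        topCoord (dim_eq_seven_add_one hA)
        (cupProduct (show 2 * 4 + 2 * 4 = 2 + 2 * 7 from rfl) (cupProduct (show 2 * 2 + 2 * 2 = 2 * 4 from rfl) (wM L) (wM K)) v') := by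
      intro L K
      have hSK : S' (wM K) = c' K • wP (Ic K) := by
        change S' (B (Set.powersetCard.map (2 * 2) (Fin.natAddEmb (2 * 4)) K)) = _
        rw [hSB, hf_minus]
      rw [hSK, map_smul, map_smul, LinearMap.smul_apply, map_smul, smul_eq_mul]
      by_cases hL : L = Ic K
      · subst hL
        have hne := hdiag' (Ic K)
        exact div_mul_cancel₀ _ hne
      · rw [beta'_frame_eq_zero_of_ne hd hA hφ e ha ha0 w b hb hSU (Ic K) L (Ne.symm hL), mul_zero,
          cup_frame_natAdd_eq_zero_of_ne_compl b hqk K L hL, LinearMap.map_zero₂, map_zero]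
    have keyy : ∀ L, ∀ y ∈ weilClassesMinus A φ 2 d,
        topCoord (dim_eq_seven_add_one hA)
        (cupProduct (show 2 * 4 + 2 * 4 = 2 + 2 * 7 from rfl) (cupProduct (show 2 * 2 + 2 * 2 = 2 * 4 from rfl) (wM L) (S' y)) (cupPowTwo (hK d φ e a) 4)) = topCoord (dim_eq_seven_add_one hA)
        (cupProduct (show 2 * 4 + 2 * 4 = 2 + 2 * 7 from rfl) (cupProduct (show 2 * 2 + 2 * 2 = 2 * 4 from rfl) (wM L) y) v') := by
      intro L y hy
      set L₁ : complexBetti A.X (2 * 2) →ₗ[ℂ] ℂ := (topCoord (dim_eq_seven_add_one hA) ∘ₗ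
        ((cupProduct (show 2 * 4 + 2 * 4 = 2 + 2 * 7 from rfl)).flip (cupPowTwo (hK d φ e a) 4)) ∘ₗ
          (cupProduct (show 2 * 2 + 2 * 2 = 2 * 4 from rfl) (wM L))) ∘ₗ S' with hL₁
      set L₂ : complexBetti A.X (2 * 2) →ₗ[ℂ] ℂ := topCoord (dim_eq_seven_add_one hA) ∘ₗ
        ((cupProduct (show 2 * 4 + 2 * 4 = 2 + 2 * 7 from rfl)).flip v') ∘ₗ
          (cupProduct (show 2 * 2 + 2 * 2 = 2 * 4 from rfl) (wM L)) with hL₂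
      have h12 : Set.EqOn L₁ L₂ (Set.range wM) := by
        rintro _ ⟨K, rfl⟩
        exact key L K
      exact LinearMap.eqOn_span h12 (weilClassesMinus_two_le_span_frame hd hA hφ e ha ha0 w b hb hy)
    intro y hy z' hz'
    set L₃ : complexBetti A.X (2 * 2) →ₗ[ℂ] ℂ := topCoord (dim_eq_seven_add_one hA) ∘ₗ
      ((cupProduct (show 2 * 4 + 2 * 4 = 2 + 2 * 7 from rfl)).flip (cupPowTwo (hK d φ e a) 4)) ∘ₗ
        ((cupProduct (show 2 * 2 + 2 * 2 = 2 * 4 from rfl)).flip (S' y)) with hL₃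
    set L₄ : complexBetti A.X (2 * 2) →ₗ[ℂ] ℂ := topCoord (dim_eq_seven_add_one hA) ∘ₗ
      ((cupProduct (show 2 * 4 + 2 * 4 = 2 + 2 * 7 from rfl)).flip v') ∘ₗ
        ((cupProduct (show 2 * 2 + 2 * 2 = 2 * 4 from rfl)).flip y) with hL₄
    have h34 : Set.EqOn L₃ L₄ (Set.range wM) := by
      rintro _ ⟨L, rfl⟩
      exact keyy L y hy
    exact LinearMap.eqOn_span h34 (weilClassesMinus_two_le_span_frame hd hA hφ e ha ha0 w b hb hz')

end Star

end Summit.HodgeConjecture.HodgeConjecture.Theorems.CYFormCarrier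

end
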